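import Summits.AnomalousDissipation.AnomalousDissipation.Theorems.QuarticGate.Negative.Laminar

/-!
# Negative knowledge for the crux `MomentParity.QuarticGate` (stmt-AnomalousDissipation-11464):
# load-bearing analysis IV — the vanishing-viscosity clause `ν_j → 0`

Certified copy of section F of the cdisprove work file `Cruxes/QuarticGate/Disproof.lean`
(refuter-cdisprove-stmt-AnomalousDissipation-11464-g2-0, cycle 2). Supports stmt-AnomalousDissipation-11464;
no positive route-item statement is asserted (the statement proved TRUE here is a strict WEAKENING of the
crux, recorded as load-bearing analysis: "any proof of `QuarticGate` must use `Tendsto ν atTop (𝓝 0)`").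

* `QuarticGateWithoutVanishingViscosity` — the crux with the clause `Tendsto ν atTop (𝓝 0)` deleted
  (positivity of the viscosities, `0 < ε`, the energy ceiling, finite fourth moments and 4-stationarity kept).
* `quarticGateWithoutVanishingViscosity_holds` — it HOLDS: at the fixed viscosity `ν_j ≡ 1` the laminar
  Kolmogorov Dirac `δ_{K_{1/(4π²)}}` of `Laminar.lean` witnesses the force `K_1` at every level `N ≥ 1`.
* `exists_loud_dirac_polyStationary_all_orders` — the same Dirac is stationary at EVERY order `d` with
  energy `(4π²ν)⁻²/2` and dissipation `(8π²ν)⁻¹`, so the weakening stays true for every `d` in place of `4`.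

With `LevelCeiling.lean` (levels must escape like `ν_j^{-1/2}`; `0 < ε` load-bearing), `EnergyRow.lean`
(`∃ f` load-bearing, `E ≥ (ε/‖f‖₂)²`) and `Laminar.lean` (energy ceiling load-bearing) the table is complete:
every clause of the crux is necessary for non-triviality.
-/

namespace Summit.AnomalousDissipation.AnomalousDissipation.Theorems.QuarticGate.Negative

open MeasureTheory Filter Topology
open scoped ENNReal InnerProductSpace RealInnerProductSpace
open Literature.Analysis.FunctionSpaces Literature.Analysis.FluidPDE
open Summit.AnomalousDissipation.AnomalousDissipation.Theses.MomentParity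

set_option linter.dupNamespace false

noncomputable section

/-! ## F. `ν_j → 0` is load-bearing: at fixed viscosity the laminar Dirac is loud -/

section FixedViscosity

/-- WEAKENING 3 (holds trivially): `QuarticGate` without `Tendsto ν atTop (𝓝 0)` (positivity of
the viscosities, `0 < ε`, the energy ceiling and 4-stationarity all kept). -/
def QuarticGateWithoutVanishingViscosity : Prop :=
  ∃ f : UnitAddTorus (Fin 3) → EuclideanSpace ℝ (Fin 3),
    Torus.IsSmooth f ∧ Torus.IsDivFree f ∧ Torus.HasZeroMean f ∧
    ∃ (ν : ℕ → ℝ) (E ε : ℝ), (∀ j, 0 < ν j) ∧ 0 < ε ∧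
    ∀ j : ℕ, ∃ᶠ N in atTop, ∃ μ, IsQuarticWitness f (ν j) N E ε μ

/-- **`ν_j → 0` is load-bearing**: at a FIXED viscosity (`ν_j ≡ 1`) the laminar Kolmogorov Dirac
`δ_{K_{1/(4π²)}}` is a witness for the force `K_1` at every level `N ≥ 1`, with `E = (4π²)⁻²/2` and
`ε = (8π²)⁻¹ > 0`. Any proof of `QuarticGate` must couple `N → ∞` with `ν_j → 0` at bounded energy:
loudness at energy `≤ E` forces mean enstrophy `≥ ε/ν_j`, carried (level ceiling) at levels
`N ≳ (ε/(4π²ν_jE))^{1/2}`. [folklore] -/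
theorem quarticGateWithoutVanishingViscosity_holds : QuarticGateWithoutVanishingViscosity := by
  refine ⟨kolField 1, isSmooth_kolField 1, isDivFree_kolField 1, hasZeroMean_kolField 1,
    fun _ => 1, (4 * Real.pi ^ 2 * 1)⁻¹ ^ 2 / 2, (8 * Real.pi ^ 2 * 1)⁻¹, fun _ => one_pos,
    by positivity, fun j => ?_⟩
  exact (eventually_ge_atTop 1).frequently.mono fun N hN =>
    ⟨_, (isQuarticWitness_dirac_kolState one_pos hN).1⟩

/-- The fixed-viscosity witnesses are EXACT steady states, hence stationary at every order: for every
`ν > 0`, `N ≥ 1` and `d`, a level-`N` probability law, polynomially `d`-stationary for the force `K_1`,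
with energy `(4π²ν)⁻²/2` and dissipation `(8π²ν)⁻¹`. [folklore] -/
theorem exists_loud_dirac_polyStationary_all_orders {ν : ℝ} (hν : 0 < ν) {N : ℕ} (hN : 1 ≤ N) (d : ℕ) :
    ∃ μ : Measure (Torus.energySpace (Fin 3)), IsProbabilityMeasure μ ∧ (∀ᵐ u ∂μ, IsLevel N u) ∧
      IsPolyStationary ν (kolField 1) N d μ ∧
      Torus.ensembleEnergy μ = (4 * Real.pi ^ 2 * ν)⁻¹ ^ 2 / 2 ∧
      Torus.ensembleDissipation ν μ = (8 * Real.pi ^ 2 * ν)⁻¹ := by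
  haveI : MeasurableSingletonClass (Torus.energySpace (Fin 3)) :=
    OpensMeasurableSpace.toMeasurableSingletonClass
  have hpi : 0 < Real.pi := Real.pi_pos
  set a : ℝ := (4 * Real.pi ^ 2 * ν)⁻¹ with ha
  have hforce : kolField 1 = kolField (4 * Real.pi ^ 2 * ν * a) := by
    rw [ha, mul_inv_cancel₀ (by positivity)]
  refine ⟨Measure.dirac (kolState a), inferInstance, ?_, ?_, ensembleEnergy_dirac_kolState a, ?_⟩
  · rw [ae_dirac_eq]; simpa using isLevel_kolState a hN
  · rw [hforce]; exact isPolyStationary_dirac_kolState ν a N d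
  · rw [ensembleDissipation_dirac_kolState, ha]
    field_simp
    ring

end FixedViscosity

end

end Summit.AnomalousDissipation.AnomalousDissipation.Theorems.QuarticGate.Negative
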